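import Summits.BirchSwinnertonDyer.BirchSwinnertonDyer.Theorems.SignedLowerHalvesSmallImageLowerHalfBothSignsRttD2SeqSemilocFrobLevel
import Summits.BirchSwinnertonDyer.BirchSwinnertonDyer.Theorems.SignedLowerHalvesSmallImageLowerHalfBothSignsRttD2SeqSemilocCoindModule
import HarnessLib

/-!
# Route `SignedLowerHalves`, crux L `SmallImageLowerHalfBothSigns` (stmt-BirchSwinnertonDyer-23599), line `rtt_w3` v32 — stub S3β″ (`stub_junctionPT_ns`), input N5-(iii)
# (unramified generator), component C4: THE FROBENIUS-VALUE RELATION IS `Λ_𝒪`-LINEAR — `c ↦ f • c` on `Lloc_w(n,k)` matches `b ↦ f • b` on `Maps(Γ_K ⧸ U_n, X_k)`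

WIDTH seat `bsd-line-slh-p3-w3` g27 under LEAD `cruxlead-stmt-BirchSwinnertonDyer-23599` g14 (cell `bsd-ssimc`); helper `--supports stmt-BirchSwinnertonDyer-23599`
(plan `Lines/rtt_w3-DESIGN-N5iii-w3-g26.md` §2 C4). THEOREMS ONLY (no definition, no named fact, no instance, no `sorry`). HONEST FRAMING: at a place `w ∉ P` with a Frobenius lift `φ̃`,
the unramified class with value `b` is unique (g27 `…SemilocFrobLevel`), so `b ↦ E b` is an additive map `Maps(Γ_K ⧸ U_n, X_k) → Lloc_w(n,k)`; it intertwines the `𝒪`-scalars and the right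
translation `R_γ` with `semilocScalar`/`semilocConj γ` (naturality), hence (Kaplansky §19 (a), tree `map_smul_of_comp_eq`) the forced `Λ_𝒪`-structures `coindModuleΛ` (g27) and
`semilocLayerModuleΛ` (g25): ★ `isFrobValue_smul` — if `c` has value `b` then `f • c` has value `f • b` for every `f ∈ Λ_𝒪`. Nothing about S3β″, crux L or BSD is proved; all remain
OPEN and are proved for NO curve.
References: [Kaplansky1954] §19; [Lang1990] Ch. 5 §1; [SerreLocalFields1979] VII §5, XIII §1; [NeukirchSchmidtWingberg2008] (1.5.2).
-/

set_option autoImplicit false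
set_option linter.dupNamespace false -- D-0017: single-problem summit, the namespace repeats the problem name by design
noncomputable section

open scoped Classical PowerSeries
open NumberField IsDedekindDomain Field CategoryTheory Function

namespace Summit.BirchSwinnertonDyer.BirchSwinnertonDyer.Theorems.SmallImageRttD2Seq

open Literature.NumberTheory.EllipticCurves Literature.NumberTheory.GaloisRepresentations
  Literature.NumberTheory.GaloisRepresentations.DiscreteGaloisModule
  Literature.NumberTheory.ComplexMultiplication.EllipticUnits Literature.NumberTheory.ComplexMultiplication.EllipticUnits.JohnsonLeungKings2011
  Literature.Algebra.Module.LocallyNilpotent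
  Summit.BirchSwinnertonDyer.BirchSwinnertonDyer.Theorems.SmallImageRttD2J1

section Smul

variable {K : Type} [Field K] [NumberField K] {p : ℕ} [Fact p.Prime] (S : Set (PadicAlgCl p)) [FiniteDimensional ℚ_[p] (padicCoeffField S)] (κ : ZpExtension K p)
  (γ : absoluteGaloisGroup K) (θ' : absoluteGaloisGroup K →ₜ* (padicCoeffIntegers S)ˣ) (P : Set (HeightOneSpectrum (𝓞 K))) (w : HeightOneSpectrum (𝓞 K))

set_option maxHeartbeats 1600000 in
/-- ★ **THE FROBENIUS-VALUE RELATION IS `Λ_𝒪`-LINEAR**: at `w ∉ P`, for `φ̃ ∈ Γ_{K_w}` of Frobenius degree one, if `c ∈ Lloc_w(n,k)` has value `b` then `f • c` has value `f • b` for every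
`f ∈ Λ_𝒪 = 𝒪⟦T⟧` — the forced structures `semilocLayerModuleΛ … γ` (on classes) and `coindModuleΛ … γ` (on coefficients) correspond. [cite: Kaplansky1954, §19 (a)] [cite: Lang1990, Ch. 5 §1]
[cite: SerreLocalFields1979, XIII §1 Prop. 1] -/
theorem isFrobValue_smul (hw : w ∉ P) (hNP : ∀ n, ramificationSubgroup K P ≤ κ.layerSubgroup n) {n k : ℕ} {φl : absoluteGaloisGroup (w.adicCompletion K)} (hφl : IsFrobPow φl 1)
    (f : IwasawaAlgebraO S) {c : semilocCoh S κ θ' P w n k 1} {b : coindFin.{0, 0} (coeffRepK S θ' P k).toTopRep (κ.layerSubgroup n)}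
    (h : IsFrobValue (semilocGalRep S κ θ' P w n k) φl c b) :
    IsFrobValue (semilocGalRep S κ θ' P w n k) φl (letI := semilocLayerModuleΛ S κ γ θ' P w n k 1; f • c) (letI := coindModuleΛ S κ γ θ' P n k; f • b) := by
  letI iO := semilocModuleO S κ θ' P w n k 1
  letI iΛ := semilocLayerModuleΛ S κ γ θ' P w n k 1
  letI jO := coindModuleO S κ θ' P n k
  letI jΛ := coindModuleΛ S κ γ θ' P n k
  -- the evaluation section `E`
  have hex : ∀ b : coindFin.{0, 0} (coeffRepK S θ' P k).toTopRep (κ.layerSubgroup n), ∃ c : semilocCoh S κ θ' P w n k 1, IsFrobValue (semilocGalRep S κ θ' P w n k) φl c b :=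
    fun b ↦ exists_isFrobValue_semiloc S κ θ' P w hw hNP n k hφl b
  choose E hE using hex
  have huniq : ∀ {c : semilocCoh S κ θ' P w n k 1} {b : coindFin.{0, 0} (coeffRepK S θ' P k).toTopRep (κ.layerSubgroup n)},
      IsFrobValue (semilocGalRep S κ θ' P w n k) φl c b → c = E b := fun hc ↦ isFrobValue_semiloc_eq_of_eq S κ θ' P w hw hNP hφl hc (hE _)
  have hadd : ∀ b b', E (b + b') = E b + E b' := fun b b' ↦ (huniq ((hE b).add (hE b'))).symm
  have hscalar : ∀ (a : padicCoeffIntegers S) b, E (coindScalar S κ θ' P n k a b) = semilocScalar S κ θ' P w n k 1 a (E b) :=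
    fun a b ↦ (huniq (isFrobValue_semilocScalar S κ θ' P w φl a (hE b))).symm
  have hconj : ∀ b, E (coindR S κ θ' P n k γ b) = semilocConj S κ θ' P w n k 1 γ (E b) :=
    fun b ↦ (huniq (isFrobValue_semilocConj S κ θ' P w φl γ (hE b))).symm
  -- `E` as an `𝒪`-linear map intertwining `ψ`
  let EL : coindFin.{0, 0} (coeffRepK S θ' P k).toTopRep (κ.layerSubgroup n) →ₗ[padicCoeffIntegers S] semilocCoh S κ θ' P w n k 1 :=
    { toFun := E
      map_add' := hadd
      map_smul' := fun a b ↦ by rw [coindModuleO_smul, hscalar]; rfl }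
  have hEψ : ∀ b, EL (coindPsi S κ γ θ' P n k b) = semilocPsi S κ θ' P w n k 1 γ (EL b) := by
    intro b
    change E (coindR S κ θ' P n k γ b - b) = semilocConj S κ θ' P w n k 1 γ (E b) - E b
    have hneg : E (-b) = -E b := (huniq (hE b).neg).symm
    rw [sub_eq_add_neg, hadd, hneg, hconj, ← sub_eq_add_neg]
  have key := map_smul_of_comp_eq (coindModuleΛ_spec S κ γ θ' P n k).1 (coindModuleΛ_spec S κ γ θ' P n k).2 (semilocLayerModuleΛ_spec S κ γ θ' P w n k 1).1
    (semilocLayerModuleΛ_spec S κ γ θ' P w n k 1).2 (coindPsi_locallyNilpotent S κ γ θ' P n k) EL hEψ f b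
  -- `f • c = f • E b = E (f • b)`, which has value `f • b`
  rw [huniq h]
  change IsFrobValue (semilocGalRep S κ θ' P w n k) φl (f • EL b) (f • b)
  rw [← key]
  exact hE _

end Smul

end Summit.BirchSwinnertonDyer.BirchSwinnertonDyer.Theorems.SmallImageRttD2Seq

end
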